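import Literature.AlgebraicGeometry.Resolution.WeightedCentreConjugation
import Mathlib.Algebra.MvPolynomial.Derivation
import HarnessLib

/-!
# The triangular flow box: straightening `ξ = ∂_{w₀} + Σ_v ℓ_v ∂_v` by a block shear (N_W core)

Uniform value line: INSTRUMENT — kernel-checked identity cores for the polynomial weighted-centre
model `W(f)` of the cell (engine 1's toy-model lemmas, here the unpinning lemma `N_W` of the
CLEAN-SUPPLIER LEMMA CS, THEOREM-FS §9.3) — NOT a resolution theorem, NOT a statement about the
Abramovich–Temkin–Włodarczyk invariant, NOT summit progress; AI-written Lean, AI review is weaker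
than expert review.

## What is typed

Polynomial ring `K[X_σ]` over a field `K`, a block `V ⊆ σ` of variables (the `V`-slots), a variable
`w₀ ∉ V`, and for each `v ∈ V` a polynomial `L_v` involving NO variable of `V`.  The block shear
`θ : X_v ↦ X_v + L_v (v ∈ V)` (`blockShear`, `WeightedCentreConjugation`) is an automorphism with
inverse `π = θ⁻¹ : X_v ↦ X_v − L_v`.

* `derivation_apply_algHom_eq_of_X` (§1) — twisted uniqueness: an algebra map `π` out of a
  polynomial ring and two derivations `ξ` (on the target) and `δ` (on the source) with
  `ξ (π Xᵢ) = π (δ Xᵢ)` on the variables satisfy `ξ ∘ π = π ∘ δ` (both sides are `π`-derivations).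
* `flowBox_conj` (§2) — **the flow box**: if a derivation `ξ` of `K[X_σ]` satisfies
  `ξ (X_v) = ∂_{w₀} L_v` for `v ∈ V` and agrees with `∂_{w₀}` on every variable off the block
  (`ξ (X_{w₀}) = 1`, `ξ (X_j) = 0` otherwise), then `ξ ∘ π = π ∘ ∂_{w₀}`: in the coordinates
  `(π X_V, X_rest)` the field `ξ` IS `∂/∂X_{w₀}`.  Consequences: `ξ H = 0 ⇒ ∂_{w₀} (θ H) = 0`
  (`pderiv_blockShear_eq_zero_of_apply_eq_zero`), and in characteristic `p`, if every exponent of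
  `X_{w₀}` in `θ H` is `< p` (e.g. by a weight bound, `apply_lt_of_isWeightedHomogeneous`), then
  `X_{w₀}` does not occur in `θ H` (`notMem_vars_blockShear_of_apply_eq_zero`, derivative criterion
  of `WeightedCentreLayerEquation`).
* §3 — the engine's explicit correction for an affine-in-`w₀` coefficient: if `∂_{w₀} ℓ = C c` and
  `c' + c' = c` then `L := X_{w₀} ℓ − c' X_{w₀}²` has `∂_{w₀} L = ℓ` (`pderiv_flowBoxCorrection`;
  `c' = c/2` when `2 ≠ 0`), involves no block variable when `ℓ` does not, and is graded of weight
  `wt w₀ + wt w₀` when `ℓ` is graded of weight `wt w₀`.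
* §4 — `flowBoxShear` = the block shear by these corrections and the assembled statement
  `notMem_vars_flowBoxShear` : for `ξ = ∂_{w₀} + Σ_{v ∈ V} ℓ_v ∂_v` with `ℓ_v` free of `V` and
  `∂_{w₀} ℓ_v` constant, `ξ H = 0` and the exponent bound give `X_{w₀} ∉ vars (θ H)`.

## Dictionary (THEOREM-FS-eng1-g35 §9.3, type `W`; CARVER-NOTES-eng1-g35 T28 (ii))

After the linear change of the `W`-coordinates making `ξ ε_w = δ_{w w₀}` (`lineSubst`,
`WeightedCentreDirectionalDerivative`), the engine's `ξ = ∂_{w₀} + Σ_v ℓ_v(ε_W) ∂_v` with LINEAR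
`ℓ_v` is the case `ℓ v := ℓ_v`, `c v := ℓ_v(e_{w₀})`, `c' v := ½ c v`; the engine's
`π(ε_v) = ε_v − ε_{w₀} ℓ_v(ε_W) + ½ ε_{w₀}² ℓ_v(e_{w₀})` is `(flowBoxShear …).symm (X v)`
(`flowBoxShear_symm_X_of_mem`), "`H′` = `H` in the new coordinates" is `flowBoxShear … H`, and
"`ξ = ∂/∂ε_{w₀}` in the system `(π ε_V, ε_W)`" is `flowBox_conj`.  The value bound "`ε_{w₀}^p` has
value `p/4 > 1`" is the hypothesis `n < p * wt w₀` of `apply_lt_of_isWeightedHomogeneous` for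
integer-scaled weights.  The final bookkeeping "the pins of `w₀` lie in `H′`, so `w₀` is unpinned
and (P) fails" is model-specific and NOT typed.

References (context only; every statement below is elementary and derived here):
[VandenessenKurodaCrachiola2021] Ch. 3 (exponential maps and slices of derivations);
[Matsumura1987] §25 (derivations, Leibniz rule); [Hironaka1970AdditiveGroups] (additive forms and
differential operators: the derivative criterion in characteristic `p`);
[CossartJannsenSaito2020] Def. 8.2 (coordinate changes `y ↦ y + q(u)`).
-/

open MvPolynomial

namespace Literature.AlgebraicGeometry.Resolution.WeightedBlowup

/-! ## §1 Twisted uniqueness: `ξ ∘ π = π ∘ δ` is decided on the variables -/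

/-- **Twisted uniqueness.**  Let `π : R[X_τ] → B` be an algebra map, `ξ` a derivation of `B` and
`δ` a derivation of `R[X_τ]`.  If `ξ (π Xᵢ) = π (δ Xᵢ)` for every variable, then
`ξ (π G) = π (δ G)` for every polynomial `G` (both `G ↦ ξ (π G)` and `G ↦ π (δ G)` satisfy the
`π`-twisted Leibniz rule, so they agree once they agree on generators; derived here).
[cite: Matsumura1987, §25 (derivations and the Leibniz rule)] -/
theorem derivation_apply_algHom_eq_of_X {R : Type*} [CommSemiring R] {τ : Type*} {B : Type*}
    [CommSemiring B] [Algebra R B] {F : Type*} [FunLike F (MvPolynomial τ R) B]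
    [AlgHomClass F R (MvPolynomial τ R) B] (π : F) (ξ : Derivation R B B)
    (δ : Derivation R (MvPolynomial τ R) (MvPolynomial τ R))
    (h : ∀ i, ξ (π (X i)) = π (δ (X i))) (G : MvPolynomial τ R) : ξ (π G) = π (δ G) := by
  induction G using MvPolynomial.induction_on with
  | C r =>
    rw [derivation_C, map_zero, ← MvPolynomial.algebraMap_eq, AlgHomClass.commutes,
      Derivation.map_algebraMap]
  | add p q hp hq => rw [map_add, map_add, map_add, map_add, hp, hq]
  | mul_X q i hq =>
    rw [map_mul, ξ.leibniz, δ.leibniz, smul_eq_mul, smul_eq_mul, smul_eq_mul, smul_eq_mul,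
      map_add, map_mul, map_mul, h i, hq]

/-! ## §2 The flow box for a block shear -/

section FlowBox

variable {K : Type*} [Field K] {σ : Type*} [DecidableEq σ]

omit [DecidableEq σ] in
/-- Off the block a derivation that agrees with `∂_{w₀}` on the variables agrees with `∂_{w₀}` on
every polynomial involving no block variable (derived here).
[cite: Matsumura1987, §25 (derivations and the Leibniz rule)] -/
theorem derivation_eq_pderiv_of_vars {V : Finset σ} {w₀ : σ}
    (ξ : Derivation K (MvPolynomial σ K) (MvPolynomial σ K))
    (hξ : ∀ j ∉ V, ξ (X j) = pderiv w₀ (X j)) {P : MvPolynomial σ K}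
    (hP : ∀ i ∈ P.vars, i ∉ V) : ξ P = pderiv w₀ P :=
  derivation_eq_of_forall_mem_vars fun i hi => hξ i (hP i hi)

/-- **The flow box.**  `V` a block, `w₀ ∉ V`, `L_v` (`v ∈ V`) free of block variables,
`θ = blockShear V L` (`X_v ↦ X_v + L_v`) with inverse `π = θ⁻¹` (`X_v ↦ X_v − L_v`).  If the
derivation `ξ` satisfies `ξ (X_v) = ∂_{w₀} L_v` on the block and agrees with `∂_{w₀}` on every
other variable, then `ξ (π G) = π (∂_{w₀} G)` for all `G`: in the coordinates `(π X_V, X_rest)`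
the field `ξ` is `∂/∂X_{w₀}` (derived here).
[cite: VandenessenKurodaCrachiola2021, Ch. 3 (exponential maps and slices of derivations)] -/
theorem flowBox_conj {V : Finset σ} {L : σ → MvPolynomial σ K}
    (hL : ∀ v ∈ V, ∀ i ∈ (L v).vars, i ∉ V) {w₀ : σ} (hw₀ : w₀ ∉ V)
    (ξ : Derivation K (MvPolynomial σ K) (MvPolynomial σ K))
    (hξV : ∀ v ∈ V, ξ (X v) = pderiv w₀ (L v)) (hξ : ∀ j ∉ V, ξ (X j) = pderiv w₀ (X j))
    (G : MvPolynomial σ K) :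
    ξ ((blockShear V L hL).symm G) = (blockShear V L hL).symm (pderiv w₀ G) := by
  refine derivation_apply_algHom_eq_of_X (blockShear V L hL).symm ξ (pderiv w₀) (fun i => ?_) G
  by_cases hi : i ∈ V
  · have hne : i ≠ w₀ := fun h => hw₀ (h ▸ hi)
    rw [blockShear_symm_X_of_mem hL hi, map_sub, hξV i hi,
      derivation_eq_pderiv_of_vars ξ hξ (hL i hi), sub_self, pderiv_X_of_ne hne, map_zero]
  · rw [blockShear_symm_X_of_not_mem hL hi, hξ i hi]
    by_cases hiw : i = w₀
    · subst hiw
      rw [pderiv_X_self, map_one]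
    · rw [pderiv_X_of_ne hiw, map_zero]

/-- **Reading `ξ H = 0` in the straightened coordinates.**  Under the hypotheses of the flow box,
`ξ H = 0` forces `∂_{w₀} (θ H) = 0` for `θ = blockShear V L` (derived here: `H = π (θ H)` and `π`
is injective). [cite: VandenessenKurodaCrachiola2021, Ch. 3 (exponential maps and slices)] -/
theorem pderiv_blockShear_eq_zero_of_apply_eq_zero {V : Finset σ} {L : σ → MvPolynomial σ K}
    (hL : ∀ v ∈ V, ∀ i ∈ (L v).vars, i ∉ V) {w₀ : σ} (hw₀ : w₀ ∉ V)
    (ξ : Derivation K (MvPolynomial σ K) (MvPolynomial σ K))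
    (hξV : ∀ v ∈ V, ξ (X v) = pderiv w₀ (L v)) (hξ : ∀ j ∉ V, ξ (X j) = pderiv w₀ (X j))
    {H : MvPolynomial σ K} (hH : ξ H = 0) : pderiv w₀ (blockShear V L hL H) = 0 := by
  have h := flowBox_conj hL hw₀ ξ hξV hξ (blockShear V L hL H)
  rw [AlgEquiv.symm_apply_apply, hH] at h
  exact (map_eq_zero_iff _ (blockShear V L hL).symm.injective).mp h.symm

omit [DecidableEq σ] in
/-- Weight bound on one exponent: if `H` is `wt`-homogeneous of weight `n` and `n < p · wt i`,
then every exponent of `X_i` in `H` is `< p` (derived here; the model's "`ε_{w₀}^p` has value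
`p · wt(w₀) > 1 = value of H`"). [cite: Hironaka1970AdditiveGroups, additive forms (weights)] -/
theorem apply_lt_of_isWeightedHomogeneous {wt : σ → ℕ} {H : MvPolynomial σ K} {n : ℕ}
    (hH : IsWeightedHomogeneous wt H n) {i : σ} {p : ℕ} (hp : n < p * wt i)
    {d : σ →₀ ℕ} (hd : d ∈ H.support) : d i < p := by
  have hw : Finsupp.weight wt d = n := hH (mem_support_iff.mp hd)
  have hle : d i * wt i ≤ Finsupp.weight wt d := by
    rw [Finsupp.weight_apply, Finsupp.sum]
    by_cases hi : i ∈ d.support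
    · exact Finset.single_le_sum (f := fun j => d j • wt j) (fun j _ => Nat.zero_le _) hi
    · rw [Finsupp.notMem_support_iff.mp hi, zero_mul]
      exact Nat.zero_le _
  rw [hw] at hle
  by_contra hcon
  have hpi : p * wt i ≤ d i * wt i := Nat.mul_le_mul_right _ (not_lt.mp hcon)
  exact absurd (lt_of_lt_of_le hp hpi) (not_lt.mpr hle)

/-- **Exit of the flow box (characteristic `p`).**  Under the hypotheses of the flow box, if
`ξ H = 0` and every exponent of `X_{w₀}` in `θ H` is `< p`, then `X_{w₀}` does not occur in `θ H`
(derived here: `∂_{w₀} (θ H) = 0` and the derivative criterion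
`notMem_vars_of_pderiv_eq_zero`). [cite: Hironaka1970AdditiveGroups, additive forms and
differential operators] -/
theorem notMem_vars_blockShear_of_apply_eq_zero (p : ℕ) [CharP K p] {V : Finset σ}
    {L : σ → MvPolynomial σ K} (hL : ∀ v ∈ V, ∀ i ∈ (L v).vars, i ∉ V) {w₀ : σ} (hw₀ : w₀ ∉ V)
    (ξ : Derivation K (MvPolynomial σ K) (MvPolynomial σ K))
    (hξV : ∀ v ∈ V, ξ (X v) = pderiv w₀ (L v)) (hξ : ∀ j ∉ V, ξ (X j) = pderiv w₀ (X j))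
    {H : MvPolynomial σ K} (hH : ξ H = 0)
    (hlt : ∀ d ∈ (blockShear V L hL H).support, d w₀ < p) :
    w₀ ∉ (blockShear V L hL H).vars :=
  notMem_vars_of_pderiv_eq_zero p (pderiv_blockShear_eq_zero_of_apply_eq_zero hL hw₀ ξ hξV hξ hH)
    hlt

/-- The graded exit: with weights `wt : σ → ℕ` for which every `L_v` is homogeneous of weight
`wt v` (so `θ` is graded) and `H` homogeneous of weight `n < p · wt w₀`, the flow box gives
`X_{w₀} ∉ vars (θ H)` (derived here). [cite: Hironaka1970AdditiveGroups, additive forms and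
differential operators] -/
theorem notMem_vars_blockShear_of_isWeightedHomogeneous (p : ℕ) [CharP K p] {V : Finset σ}
    {L : σ → MvPolynomial σ K} (hL : ∀ v ∈ V, ∀ i ∈ (L v).vars, i ∉ V) {w₀ : σ} (hw₀ : w₀ ∉ V)
    (ξ : Derivation K (MvPolynomial σ K) (MvPolynomial σ K))
    (hξV : ∀ v ∈ V, ξ (X v) = pderiv w₀ (L v)) (hξ : ∀ j ∉ V, ξ (X j) = pderiv w₀ (X j))
    {wt : σ → ℕ} (hLw : ∀ v ∈ V, IsWeightedHomogeneous wt (L v) (wt v))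
    {H : MvPolynomial σ K} {n : ℕ} (hHw : IsWeightedHomogeneous wt H n) (hp : n < p * wt w₀)
    (hH : ξ H = 0) : w₀ ∉ (blockShear V L hL H).vars :=
  notMem_vars_blockShear_of_apply_eq_zero p hL hw₀ ξ hξV hξ hH fun _ hd =>
    apply_lt_of_isWeightedHomogeneous (isWeightedHomogeneous_blockShear wt hL hLw hHw) hp hd

end FlowBox

/-! ## §3 The explicit correction for an affine-in-`w₀` coefficient -/

section Correction

variable {K : Type*} [Field K] {σ : Type*}

/-- The engine's correction term `L = X_{w₀}·ℓ − c'·X_{w₀}²` (`c' = ½ ℓ(e_{w₀})` in the model), an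
antiderivative of `ℓ` in the variable `X_{w₀}` when `∂_{w₀} ℓ = C (c' + c')`.
[cite: VandenessenKurodaCrachiola2021, Ch. 3 (exponential maps and slices of derivations)] -/
noncomputable def flowBoxCorrection (w₀ : σ) (ℓ : MvPolynomial σ K) (c' : K) : MvPolynomial σ K :=
  X w₀ * ℓ - C c' * X w₀ ^ 2

/-- `∂_{w₀} (X_{w₀} ℓ − c' X_{w₀}²) = ℓ` whenever `∂_{w₀} ℓ = C c` with `c' + c' = c` (derived here;
two applications of the Leibniz rule). [cite: Matsumura1987, §25 (derivations and the Leibniz rule)] -/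
theorem pderiv_flowBoxCorrection {w₀ : σ} {ℓ : MvPolynomial σ K} {c c' : K} (hc : c' + c' = c)
    (hℓ : pderiv w₀ ℓ = C c) : pderiv w₀ (flowBoxCorrection w₀ ℓ c') = ℓ := by
  have e₁ : (C c' : MvPolynomial σ K) + C c' = C c := by rw [← map_add, hc]
  unfold flowBoxCorrection
  rw [map_sub, pderiv_mul, pderiv_X_self, hℓ, pderiv_C_mul, sq, pderiv_mul, pderiv_X_self]
  linear_combination (-(X w₀ : MvPolynomial σ K)) * e₁

/-- With `2 ≠ 0` in `K`, the choice `c' = c / 2` (derived here).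
[cite: Matsumura1987, §25 (derivations and the Leibniz rule)] -/
theorem pderiv_flowBoxCorrection_half (h2 : (2 : K) ≠ 0) {w₀ : σ} {ℓ : MvPolynomial σ K} {c : K}
    (hℓ : pderiv w₀ ℓ = C c) : pderiv w₀ (flowBoxCorrection w₀ ℓ (c / 2)) = ℓ :=
  pderiv_flowBoxCorrection (by rw [← add_div, ← two_mul, mul_div_cancel_left₀ c h2]) hℓ

/-- The correction involves only `X_{w₀}` and the variables of `ℓ` (derived here).
[cite: CossartJannsenSaito2020, Def. 8.2 (coordinate changes `y ↦ y + q(u)`)] -/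
theorem mem_vars_flowBoxCorrection [DecidableEq σ] {w₀ : σ} {ℓ : MvPolynomial σ K} {c' : K}
    {i : σ} (hi : i ∈ (flowBoxCorrection w₀ ℓ c').vars) : i = w₀ ∨ i ∈ ℓ.vars := by
  unfold flowBoxCorrection at hi
  have hXw : ∀ j, j ∈ (X w₀ : MvPolynomial σ K).vars → j = w₀ := fun j hj => by
    rw [vars_X] at hj
    exact Finset.mem_singleton.mp hj
  rcases Finset.mem_union.mp (vars_sub_subset _ hi) with h | h
  · rcases Finset.mem_union.mp (vars_mul _ _ h) with h' | h'
    · exact Or.inl (hXw i h')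
    · exact Or.inr h'
  · rcases Finset.mem_union.mp (vars_mul _ _ h) with h' | h'
    · rw [vars_C] at h'
      exact absurd h' (Finset.notMem_empty i)
    · exact Or.inl (hXw i (vars_pow _ _ h'))

/-- If `ℓ` involves no block variable and `w₀ ∉ V`, neither does the correction (derived here) —
the hypothesis of `blockShear`. [cite: CossartJannsenSaito2020, Def. 8.2] -/
theorem vars_flowBoxCorrection_not_mem [DecidableEq σ] {V : Finset σ} {w₀ : σ} (hw₀ : w₀ ∉ V)
    {ℓ : MvPolynomial σ K} (hℓ : ∀ i ∈ ℓ.vars, i ∉ V) (c' : K) :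
    ∀ i ∈ (flowBoxCorrection w₀ ℓ c').vars, i ∉ V := fun i hi => by
  rcases mem_vars_flowBoxCorrection hi with h | h
  · exact h ▸ hw₀
  · exact hℓ i h

/-- The correction is graded: if `ℓ` is `wt`-homogeneous of weight `wt w₀`, then
`X_{w₀} ℓ − c' X_{w₀}²` is `wt`-homogeneous of weight `wt w₀ + wt w₀` (derived here; in the model
`wt W = ¼`, `wt V = ½`). [cite: AbramovichTemkinWlodarczyk2024, Lemma 5.2.10 (graded coordinate changes)] -/
theorem isWeightedHomogeneous_flowBoxCorrection {M : Type*} [AddCommMonoid M] (wt : σ → M)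
    {w₀ : σ} {ℓ : MvPolynomial σ K} (hℓ : IsWeightedHomogeneous wt ℓ (wt w₀)) (c' : K) :
    IsWeightedHomogeneous wt (flowBoxCorrection w₀ ℓ c') (wt w₀ + wt w₀) := by
  unfold flowBoxCorrection
  have h1 : IsWeightedHomogeneous wt (X w₀ * ℓ) (wt w₀ + wt w₀) :=
    (isWeightedHomogeneous_X K wt w₀).mul hℓ
  have h2 : IsWeightedHomogeneous wt (C c' * X w₀ ^ 2) (wt w₀ + wt w₀) := by
    have h := (isWeightedHomogeneous_C wt c').mul
      ((isWeightedHomogeneous_X K wt w₀).mul (isWeightedHomogeneous_X K wt w₀))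
    rwa [zero_add, ← sq] at h
  rw [← mem_weightedHomogeneousSubmodule] at h1 h2 ⊢
  exact Submodule.sub_mem _ h1 h2

end Correction

/-! ## §4 The flow-box shear and the assembled `N_W` statement -/

section Assembled

variable {K : Type*} [Field K] {σ : Type*} [DecidableEq σ]

/-- **The flow-box shear** `θ : X_v ↦ X_v + (X_{w₀} ℓ_v − c'_v X_{w₀}²) (v ∈ V)`, other variables
fixed — an automorphism because no `ℓ_v` involves a block variable and `w₀ ∉ V`; its inverse
`θ⁻¹ : X_v ↦ X_v − X_{w₀} ℓ_v + c'_v X_{w₀}²` is the engine's `π`.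
[cite: VandenessenKurodaCrachiola2021, Ch. 3 (exponential maps and slices of derivations)]
[cite: CossartJannsenSaito2020, Def. 8.2 (coordinate changes `y ↦ y + q(u)`)] -/
noncomputable def flowBoxShear (V : Finset σ) (w₀ : σ) (ℓ : σ → MvPolynomial σ K) (c' : σ → K)
    (hw₀ : w₀ ∉ V) (hℓV : ∀ v ∈ V, ∀ i ∈ (ℓ v).vars, i ∉ V) :
    MvPolynomial σ K ≃ₐ[K] MvPolynomial σ K :=
  blockShear V (fun v => flowBoxCorrection w₀ (ℓ v) (c' v))
    fun v hv => vars_flowBoxCorrection_not_mem hw₀ (hℓV v hv) (c' v)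

variable {V : Finset σ} {w₀ : σ} {ℓ : σ → MvPolynomial σ K} {c' : σ → K} (hw₀ : w₀ ∉ V)
  (hℓV : ∀ v ∈ V, ∀ i ∈ (ℓ v).vars, i ∉ V)

/-- (derived here) [cite: CossartJannsenSaito2020, Def. 8.2] -/
theorem flowBoxShear_X_of_mem {v : σ} (hv : v ∈ V) :
    flowBoxShear V w₀ ℓ c' hw₀ hℓV (X v) = X v + (X w₀ * ℓ v - C (c' v) * X w₀ ^ 2) :=
  blockShear_X_of_mem _ hv

/-- The engine's `π(ε_v) = ε_v − ε_{w₀} ℓ_v + c'_v ε_{w₀}²` is `θ⁻¹ (X v)` (derived here).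
[cite: VandenessenKurodaCrachiola2021, Ch. 3 (exponential maps and slices of derivations)] -/
theorem flowBoxShear_symm_X_of_mem {v : σ} (hv : v ∈ V) :
    (flowBoxShear V w₀ ℓ c' hw₀ hℓV).symm (X v) = X v - (X w₀ * ℓ v - C (c' v) * X w₀ ^ 2) :=
  blockShear_symm_X_of_mem _ hv

/-- (derived here) [cite: CossartJannsenSaito2020, Def. 8.2] -/
theorem flowBoxShear_X_of_not_mem {i : σ} (hi : i ∉ V) :
    flowBoxShear V w₀ ℓ c' hw₀ hℓV (X i) = X i :=
  blockShear_X_of_not_mem _ hi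

/-- (derived here) [cite: CossartJannsenSaito2020, Def. 8.2] -/
theorem flowBoxShear_symm_X_of_not_mem {i : σ} (hi : i ∉ V) :
    (flowBoxShear V w₀ ℓ c' hw₀ hℓV).symm (X i) = X i :=
  blockShear_symm_X_of_not_mem _ hi

/-- The flow-box shear is graded when every `ℓ_v` is homogeneous of weight `wt w₀` and
`wt v = wt w₀ + wt w₀` on the block (derived here).
[cite: AbramovichTemkinWlodarczyk2024, Lemma 5.2.10 (graded coordinate changes)] -/
theorem isWeightedHomogeneous_flowBoxShear {M : Type*} [AddCommMonoid M] (wt : σ → M)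
    (hℓw : ∀ v ∈ V, IsWeightedHomogeneous wt (ℓ v) (wt w₀)) (hVw : ∀ v ∈ V, wt v = wt w₀ + wt w₀)
    {P : MvPolynomial σ K} {n : M} (hP : IsWeightedHomogeneous wt P n) :
    IsWeightedHomogeneous wt (flowBoxShear V w₀ ℓ c' hw₀ hℓV P) n :=
  isWeightedHomogeneous_blockShear wt _
    (fun v hv => (hVw v hv).symm ▸ isWeightedHomogeneous_flowBoxCorrection wt (hℓw v hv) (c' v)) hP

/-- **`ξ = ∂_{w₀} + Σ_{v ∈ V} ℓ_v ∂_v` is straightened by the flow-box shear**: if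
`∂_{w₀} ℓ_v = C (c'_v + c'_v)` on the block, `ξ (X v) = ℓ_v` (`v ∈ V`), `ξ (X_{w₀}) = 1` and
`ξ (X_j) = 0` for every other variable, then `ξ (θ⁻¹ G) = θ⁻¹ (∂_{w₀} G)` (derived here; the
engine's two-line check `ξ π(ε_v) = ℓ_v − ℓ_v − ε_{w₀}ℓ_v(e_{w₀}) + ε_{w₀}ℓ_v(e_{w₀}) = 0`).
[cite: VandenessenKurodaCrachiola2021, Ch. 3 (exponential maps and slices of derivations)] -/
theorem flowBoxShear_conj {c : σ → K} (hc : ∀ v ∈ V, c' v + c' v = c v)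
    (hℓ : ∀ v ∈ V, pderiv w₀ (ℓ v) = C (c v))
    (ξ : Derivation K (MvPolynomial σ K) (MvPolynomial σ K)) (hξV : ∀ v ∈ V, ξ (X v) = ℓ v)
    (hξw : ξ (X w₀) = 1) (hξ0 : ∀ j ∉ V, j ≠ w₀ → ξ (X j) = 0) (G : MvPolynomial σ K) :
    ξ ((flowBoxShear V w₀ ℓ c' hw₀ hℓV).symm G) =
      (flowBoxShear V w₀ ℓ c' hw₀ hℓV).symm (pderiv w₀ G) := by
  refine flowBox_conj _ hw₀ ξ (fun v hv => ?_) (fun j hj => ?_) G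
  · rw [hξV v hv, pderiv_flowBoxCorrection (hc v hv) (hℓ v hv)]
  · by_cases hjw : j = w₀
    · subst hjw
      rw [hξw, pderiv_X_self]
    · rw [hξ0 j hj hjw, pderiv_X_of_ne hjw]

/-- `ξ H = 0 ⇒ ∂_{w₀} (θ H) = 0` for the flow-box shear `θ` (derived here).
[cite: VandenessenKurodaCrachiola2021, Ch. 3 (exponential maps and slices of derivations)] -/
theorem pderiv_flowBoxShear_eq_zero {c : σ → K} (hc : ∀ v ∈ V, c' v + c' v = c v)
    (hℓ : ∀ v ∈ V, pderiv w₀ (ℓ v) = C (c v))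
    (ξ : Derivation K (MvPolynomial σ K) (MvPolynomial σ K)) (hξV : ∀ v ∈ V, ξ (X v) = ℓ v)
    (hξw : ξ (X w₀) = 1) (hξ0 : ∀ j ∉ V, j ≠ w₀ → ξ (X j) = 0) {H : MvPolynomial σ K}
    (hH : ξ H = 0) : pderiv w₀ (flowBoxShear V w₀ ℓ c' hw₀ hℓV H) = 0 := by
  have h := flowBoxShear_conj hw₀ hℓV hc hℓ ξ hξV hξw hξ0 (flowBoxShear V w₀ ℓ c' hw₀ hℓV H)
  rw [AlgEquiv.symm_apply_apply, hH] at h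
  exact (map_eq_zero_iff _ (flowBoxShear V w₀ ℓ c' hw₀ hℓV).symm.injective).mp h.symm

/-- **`N_W` core (characteristic `p`).**  `ξ = ∂_{w₀} + Σ_{v ∈ V} ℓ_v ∂_v` with `ℓ_v` free of the
block and `∂_{w₀} ℓ_v = C (c'_v + c'_v)`; if `ξ H = 0` and every exponent of `X_{w₀}` in `θ H` is
`< p`, then `X_{w₀}` does not occur in `θ H` — in the straightened coordinates `H` is free of
`ε_{w₀}` (derived here). [cite: Hironaka1970AdditiveGroups, additive forms and differential
operators] [cite: VandenessenKurodaCrachiola2021, Ch. 3 (exponential maps and slices)] -/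
theorem notMem_vars_flowBoxShear (p : ℕ) [CharP K p] {c : σ → K}
    (hc : ∀ v ∈ V, c' v + c' v = c v) (hℓ : ∀ v ∈ V, pderiv w₀ (ℓ v) = C (c v))
    (ξ : Derivation K (MvPolynomial σ K) (MvPolynomial σ K)) (hξV : ∀ v ∈ V, ξ (X v) = ℓ v)
    (hξw : ξ (X w₀) = 1) (hξ0 : ∀ j ∉ V, j ≠ w₀ → ξ (X j) = 0) {H : MvPolynomial σ K}
    (hH : ξ H = 0) (hlt : ∀ d ∈ (flowBoxShear V w₀ ℓ c' hw₀ hℓV H).support, d w₀ < p) :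
    w₀ ∉ (flowBoxShear V w₀ ℓ c' hw₀ hℓV H).vars :=
  notMem_vars_of_pderiv_eq_zero p (pderiv_flowBoxShear_eq_zero hw₀ hℓV hc hℓ ξ hξV hξw hξ0 hH)
    hlt

/-- **`N_W` core, graded form.**  With integer-scaled weights `wt` (every `ℓ_v` homogeneous of
weight `wt w₀`, `wt v = 2·wt w₀` on the block, `H` homogeneous of weight `n`) and the value bound
`n < p · wt w₀`, the flow box gives `X_{w₀} ∉ vars (θ H)` from `ξ H = 0` alone (derived here; the
model: `wt W = ¼`, `wt V = ½`, `H` of value `1`, `p/4 > 1`).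
[cite: Hironaka1970AdditiveGroups, additive forms and differential operators] -/
theorem notMem_vars_flowBoxShear_of_isWeightedHomogeneous (p : ℕ) [CharP K p] {c : σ → K}
    (hc : ∀ v ∈ V, c' v + c' v = c v) (hℓ : ∀ v ∈ V, pderiv w₀ (ℓ v) = C (c v))
    (ξ : Derivation K (MvPolynomial σ K) (MvPolynomial σ K)) (hξV : ∀ v ∈ V, ξ (X v) = ℓ v)
    (hξw : ξ (X w₀) = 1) (hξ0 : ∀ j ∉ V, j ≠ w₀ → ξ (X j) = 0)
    {wt : σ → ℕ} (hℓw : ∀ v ∈ V, IsWeightedHomogeneous wt (ℓ v) (wt w₀))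
    (hVw : ∀ v ∈ V, wt v = wt w₀ + wt w₀) {H : MvPolynomial σ K} {n : ℕ}
    (hHw : IsWeightedHomogeneous wt H n) (hp : n < p * wt w₀) (hH : ξ H = 0) :
    w₀ ∉ (flowBoxShear V w₀ ℓ c' hw₀ hℓV H).vars :=
  notMem_vars_flowBoxShear hw₀ hℓV p hc hℓ ξ hξV hξw hξ0 hH fun _ hd =>
    apply_lt_of_isWeightedHomogeneous
      (isWeightedHomogeneous_flowBoxShear hw₀ hℓV wt hℓw hVw hHw) hp hd

end Assembled

end Literature.AlgebraicGeometry.Resolution.WeightedBlowup
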